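import Summits.BirchSwinnertonDyer.BirchSwinnertonDyer.Theorems.PrintCf2RamifiedOffTYZSquareSilenceSixPQ
import HarnessLib

/-!
# Crux `PrintCf2.RamifiedOffTYZOfFacts` (stmt-BirchSwinnertonDyer-20509), line `offtyz-v7`, LEAD cycle 13 (cruxlead-20509 g12):
# THE THREE-PARAMETER EVEN CELL `n = 2rpq` — `r ≡ 3 (mod 4)`, `p ≡ q ≡ 1 (mod 8)`, `(−r/p) = (−r/q) = 1`, `(p/q) = −1` (`#Sel₂(E_n) = 2⁵`):
# pair witness `φ_pφ_q`, even coefficients on `2rp`, `2rq`, and the LOWER HALF of C⁺ from the named facts (generalises `…SquareSilenceSixPQ`, `r = 3`)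

THEOREMS ONLY (no `def`, no named fact, no `sorry`), `--supports stmt-BirchSwinnertonDyer-20509` (item 23431 = C⁺, even three-prime sectors).  Verbatim the
`r = 3` file (p736493) with the small prime `3` replaced by any prime `r ≡ 3 (mod 4)` and the congruences `p ≡ q ≡ 1 (mod 24)` replaced by `p ≡ q ≡ 1 (mod 8)`
plus the two Legendre conditions `(−r/p) = (−r/q) = 1` (for `r = 3` these say `p ≡ q ≡ 1 (mod 3)`).  Divisors of `2rpq`: `≡ 6 (mod 8)` exactly `2r, 2rp,
2rq, 2rpq`; none `≡ 5`; the blocks `r, rp, rq, rpq ≡ 3, 7 (mod 8)` never move.  Monsky: the even matrix of `(r, p, q)` has rank `3` for both `r ≡ 3` and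
`r ≡ 7 (mod 8)`, so `s(n) = 3` on the whole cell (LEAD computation, crux workfile `Lines/offtyz_v7_EvenTwoPrimes.md`).
* `divisors_two_mul_three'`, `trivialOnL_pair'`, `two_dvd_scriptL_two_rpq_of_valuePrinted`, ★ **`two_dvd_scriptL_two_rpq_of_facts :
  (tyz_cmPointRingClassFrobeniusValueData ∧ thm11_parity_of_scriptL ∧ GZK) → ∀ n r p q, … → ∀ L, IsScriptL n L → 2 ∣ L`**.
Beyond-print theorem: YES (conditional on the three named facts).  BSD is not proved by any of this; no class is closed by this file.

References: [cite: TianYuanZhang2017, Thm. 1.1, §1 (p0002 L101–L110), §3.1 (p0011 L1–L73), Prop. 3.2 (2), Thm. 3.5, Thm. 3.6 (2), Lemma 3.18, proof of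
Lemma 3.21]; [cite: Cox2013, §5.C Lemma 5.19, (5.22), Thm. 5.23, Cor. 5.25, §9.A]; [cite: HeathBrown1994SelmerCongruentII, §1, Appendix (Monsky)];
[cite: Stevenhagen1995RedeiMatrices, §2]; [cite: Darmon2004, Thm. 3.22].
-/

noncomputable section

open scoped Classical

open WeierstrassCurve WeierstrassCurve.Affine Finset Literature.NumberTheory.EllipticCurves
  Literature.NumberTheory.EllipticCurves.TianYuanZhang2017
  Literature.NumberTheory.EllipticCurves.TianYuanZhang2017.W2
  Summit.BirchSwinnertonDyer.Rank1Residual.P2.GenusPeriodTransferLayer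
  Summit.BirchSwinnertonDyer.Rank1Residual.P2
  Summit.BirchSwinnertonDyer.PrintCf2.MoverAssembly
  Summit.BirchSwinnertonDyer.PrintCf2.SquareSilenceEven
  Summit.BirchSwinnertonDyer.PrintCf2.SquareSilenceCoefficients
  Summit.BirchSwinnertonDyer.PrintCf2.FrobeniusPairWitness
  Summit.BirchSwinnertonDyer.PrintCf2.LowerHalfTwoPrimesEvenDisplays
  Summit.BirchSwinnertonDyer.PrintCf2.SixPQ

set_option autoImplicit false

namespace Summit.BirchSwinnertonDyer.PrintCf2.TwoRPQ

variable {n : ℕ} (D : GenusPointData n)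

/-! ## §1 Divisors of `2rpq` -/

/-- **Residues of the divisors of `2rpq`** (`r ≡ 3 (mod 4)`, `p, q ≡ 1 (mod 8)` primes): a divisor `≡ 6 (mod 8)` is `2r, 2rp, 2rq` or `2rpq`; none is
`≡ 5 (mod 8)`. [cite: TianYuanZhang2017, §3.1 (p0011 L67–L70)] -/
theorem divisors_two_mul_three' {r p q : ℕ} (hr : Nat.Prime r) (hp : Nat.Prime p) (hq : Nat.Prime q) (hr4 : r % 4 = 3) (hp8 : p % 8 = 1)
    (hq8 : q % 8 = 1) {d : ℕ} (hd : d ∣ 2 * r * p * q) :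
    d % 8 ≠ 5 ∧ (d % 8 = 6 → d = 2 * r ∨ d = 2 * r * p ∨ d = 2 * r * q ∨ d = 2 * r * p * q) := by
  have hd' : d ∣ 2 * (r * p * q) := by rw [show 2 * (r * p * q) = 2 * r * p * q by ring]; exact hd
  have hrp : (r * p) % 8 = r % 8 := by rw [Nat.mul_mod, hp8, mul_one, Nat.mod_mod]
  have hrq : (r * q) % 8 = r % 8 := by rw [Nat.mul_mod, hq8, mul_one, Nat.mod_mod]
  have hpq : (p * q) % 8 = 1 := by rw [Nat.mul_mod, hp8, hq8]
  have hrpq : (r * p * q) % 8 = r % 8 := by rw [Nat.mul_mod, hrp, hq8, mul_one, Nat.mod_mod]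
  have hr8 : r % 8 = 3 ∨ r % 8 = 7 := by omega
  rcases SixPQ.dvd_or_two_mul_dvd_of_dvd_two_mul hd' with h | ⟨d', rfl, h⟩
  · rcases (dvd_mul_three_iff hr hp hq).mp h with rfl | rfl | rfl | rfl | rfl | rfl | rfl | rfl <;> omega
  · rcases (dvd_mul_three_iff hr hp hq).mp h with rfl | rfl | rfl | rfl | rfl | rfl | rfl | rfl
    · omega
    · exact ⟨by omega, fun _ => Or.inl rfl⟩
    · omega
    · omega
    · exact ⟨by omega, fun _ => Or.inr (Or.inl (by ring))⟩
    · exact ⟨by omega, fun _ => Or.inr (Or.inr (Or.inl (by ring)))⟩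
    · omega
    · exact ⟨by omega, fun _ => Or.inr (Or.inr (Or.inr (by ring)))⟩

/-! ## §2 The pair `φ_pφ_q` is trivial on `L_n(i)` for `n = 2rpq` -/

/-- **The Frobenius pair `φ_pφ_q` of `n = 2rpq` is trivial on `L_n(i)`** when `p ≡ q ≡ 1 (mod 8)`, `(−r/p) = (−r/q) = 1` and `(p/q) = −1`: each factor fixes
`i, √−2, √−r`, moves the other large prime's root (`(−q/p) = (p/q) = −1`) and — since it fixes `√−n` — its own, so the product fixes everything. [cite: TianYuanZhang2017, §3.1 (p0011 L60–L66), Prop. 3.2 (2)] [cite: Cox2013, §5.C (5.22), §1 (1.13)–(1.15)] -/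
theorem trivialOnL_pair' (hsq : Squarefree n) {r p q : ℕ} (hr : r.Prime) (hp : p.Prime) (hq : q.Prime) (hpq : p ≠ q) (hn : n = 2 * r * p * q)
    (hr4 : r % 4 = 3) (hp8 : p % 8 = 1) (hq8 : q % 8 = 1) (hrp : jacobiSym (-(r : ℤ)) p = 1) (hrq : jacobiSym (-(r : ℤ)) q = 1)
    (hleg : jacobiSym p q = -1)
    {φ₁ φ₂ : D.H ≃ₐ[ℚ] D.H}
    (h₁K : φ₁ (D.sqrtNeg n) = D.sqrtNeg n) (h₁i : φ₁ D.im = (jacobiSym (-1) p) • D.im)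
    (h₁r : ∀ r : ℕ, r.Prime → r ∣ n → r ≠ p → φ₁ (D.sqrtNeg r) = (jacobiSym (-(r : ℤ)) p) • D.sqrtNeg r)
    (h₂K : φ₂ (D.sqrtNeg n) = D.sqrtNeg n) (h₂i : φ₂ D.im = (jacobiSym (-1) q) • D.im)
    (h₂r : ∀ r : ℕ, r.Prime → r ∣ n → r ≠ q → φ₂ (D.sqrtNeg r) = (jacobiSym (-(r : ℤ)) q) • D.sqrtNeg r) :
    D.TrivialOnL n (φ₁ * φ₂) := by
  have hn0 : n ≠ 0 := hsq.ne_zero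
  have hm : ∀ {d : ℕ}, d ∣ n → d ∈ n.divisors := fun hd => Nat.mem_divisors.mpr ⟨hd, hn0⟩
  have hp2 : p ≠ 2 := by omega
  have hq2 : q ≠ 2 := by omega
  have hpr : p ≠ r := by rintro rfl; omega
  have hqr : q ≠ r := by rintro rfl; omega
  have hr2 : r ≠ 2 := by omega
  -- divisibility bookkeeping
  have d2 : 2 ∣ n := ⟨r * p * q, by rw [hn]; ring⟩
  have d3 : r ∣ n := ⟨2 * p * q, by rw [hn]; ring⟩
  have dp : p ∣ n := ⟨2 * r * q, by rw [hn]; ring⟩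
  have dq : q ∣ n := ⟨2 * r * p, by rw [hn]; ring⟩
  have d6 : 2 * r ∣ n := ⟨p * q, by rw [hn]; ring⟩
  have d6p : 2 * r * p ∣ n := ⟨q, by rw [hn]⟩
  have d6q : 2 * r * q ∣ n := ⟨p, by rw [hn]; ring⟩
  have hn' : 2 * r * p * q ∈ n.divisors := by rw [← hn]; exact Nat.mem_divisors_self n hn0
  have hn'' : 2 * r * q * p ∈ n.divisors := by rw [show 2 * r * q * p = n by rw [hn]; ring]; exact Nat.mem_divisors_self n hn0
  -- Legendre values
  have hqp : jacobiSym q p = -1 := by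
    rw [jacobiSym.quadratic_reciprocity_one_mod_four' (hq.odd_of_ne_two hq2) (by omega : p % 4 = 1)]; exact hleg
  have v1i : jacobiSym (-1) p = 1 := jacobiSym_neg_one_eq_one hp (by omega)
  have v2i : jacobiSym (-1) q = 1 := jacobiSym_neg_one_eq_one hq (by omega)
  -- actions of `φ₁`
  have a1i : φ₁ D.im = D.im := by rw [h₁i, v1i, one_smul]
  have a12 : φ₁ (D.sqrtNeg 2) = D.sqrtNeg 2 := by
    rw [h₁r 2 Nat.prime_two d2 hp2.symm, show (-((2 : ℕ) : ℤ)) = -2 by norm_num, jacobiSym_neg_two_eq_one hp (by omega), one_smul]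
  have a13 : φ₁ (D.sqrtNeg r) = D.sqrtNeg r := by
    rw [h₁r r hr d3 hpr.symm, hrp, one_smul]
  have a1q : φ₁ (D.sqrtNeg q) = -D.sqrtNeg q := by
    rw [h₁r q hq dq hpq.symm, neg_eq_neg_one_mul, jacobiSym.mul_left, v1i, one_mul, hqp, neg_one_smul]
  -- actions of `φ₂`
  have a2i : φ₂ D.im = D.im := by rw [h₂i, v2i, one_smul]
  have a22 : φ₂ (D.sqrtNeg 2) = D.sqrtNeg 2 := by
    rw [h₂r 2 Nat.prime_two d2 hq2.symm, show (-((2 : ℕ) : ℤ)) = -2 by norm_num, jacobiSym_neg_two_eq_one hq (by omega), one_smul]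
  have a23 : φ₂ (D.sqrtNeg r) = D.sqrtNeg r := by
    rw [h₂r r hr d3 hqr.symm, hrq, one_smul]
  have a2p : φ₂ (D.sqrtNeg p) = -D.sqrtNeg p := by
    rw [h₂r p hp dp hpq, neg_eq_neg_one_mul, jacobiSym.mul_left, v2i, one_mul, hleg, neg_one_smul]
  -- self-signs through `√−n`: `φ₁` negates `√−p`, `φ₂` negates `√−q`
  have a16 : φ₁ (D.sqrtNeg (2 * r)) = D.sqrtNeg (2 * r) := apply_sqrtNeg_mul_eq D (hm d2) (hm d3) (hm d6) a1i a12 a13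
  have a26 : φ₂ (D.sqrtNeg (2 * r)) = D.sqrtNeg (2 * r) := apply_sqrtNeg_mul_eq D (hm d2) (hm d3) (hm d6) a2i a22 a23
  have h₁K' : φ₁ (D.sqrtNeg (2 * r * p * q)) = D.sqrtNeg (2 * r * p * q) := by rw [← hn]; exact h₁K
  have h₂K' : φ₂ (D.sqrtNeg (2 * r * q * p)) = D.sqrtNeg (2 * r * q * p) := by
    rw [show 2 * r * q * p = n by rw [hn]; ring]; exact h₂K
  have a16p : φ₁ (D.sqrtNeg (2 * r * p)) = -D.sqrtNeg (2 * r * p) := SixPQ.apply_sqrtNeg_eq_neg_of_mul D (hm d6p) (hm dq) hn' a1i h₁K' a1q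
  have a1p : φ₁ (D.sqrtNeg p) = -D.sqrtNeg p := SixPQ.apply_sqrtNeg_eq_neg_of_mul' D (hm d6) (hm dp) (hm d6p) a1i a16 a16p
  have a26q : φ₂ (D.sqrtNeg (2 * r * q)) = -D.sqrtNeg (2 * r * q) := SixPQ.apply_sqrtNeg_eq_neg_of_mul D (hm d6q) (hm dp) hn'' a2i h₂K' a2p
  have a2q : φ₂ (D.sqrtNeg q) = -D.sqrtNeg q := SixPQ.apply_sqrtNeg_eq_neg_of_mul' D (hm d6) (hm dq) (hm d6q) a2i a26 a26q
  -- the product fixes `i, √−2, √−3, √−p, √−q`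
  have ei : (φ₁ * φ₂) D.im = D.im := by rw [AlgEquiv.mul_apply, a2i, a1i]
  have e2 : (φ₁ * φ₂) (D.sqrtNeg 2) = D.sqrtNeg 2 := by rw [AlgEquiv.mul_apply, a22, a12]
  have e3 : (φ₁ * φ₂) (D.sqrtNeg r) = D.sqrtNeg r := by rw [AlgEquiv.mul_apply, a23, a13]
  have ep : (φ₁ * φ₂) (D.sqrtNeg p) = D.sqrtNeg p := by rw [AlgEquiv.mul_apply, a2p, map_neg, a1p, neg_neg]
  have eq' : (φ₁ * φ₂) (D.sqrtNeg q) = D.sqrtNeg q := by rw [AlgEquiv.mul_apply, a2q, map_neg, a1q, neg_neg]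
  -- all divisors
  have F : ∀ {a b : ℕ}, a ∣ n → b ∣ n → a * b ∣ n → (φ₁ * φ₂) (D.sqrtNeg a) = D.sqrtNeg a →
      (φ₁ * φ₂) (D.sqrtNeg b) = D.sqrtNeg b → (φ₁ * φ₂) (D.sqrtNeg (a * b)) = D.sqrtNeg (a * b) :=
    fun ha hb hab h1 h2 => apply_sqrtNeg_mul_eq D (hm ha) (hm hb) (hm hab) ei h1 h2
  have d3p : r * p ∣ n := ⟨2 * q, by rw [hn]; ring⟩
  have d3q : r * q ∣ n := ⟨2 * p, by rw [hn]; ring⟩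
  have dpq : p * q ∣ n := ⟨2 * r, by rw [hn]; ring⟩
  have d3pq : r * p * q ∣ n := ⟨2, by rw [hn]; ring⟩
  have e3p := F d3 dp d3p e3 ep
  have e3q := F d3 dq d3q e3 eq'
  have epq := F dp dq dpq ep eq'
  have e3pq := F d3p dq d3pq e3p eq'
  refine ⟨ei, fun d hd hd1 => ?_⟩
  have hdvd : d ∣ 2 * (r * p * q) := by rw [show 2 * (r * p * q) = n by rw [hn]; ring]; exact Nat.dvd_of_mem_divisors hd
  rcases SixPQ.dvd_or_two_mul_dvd_of_dvd_two_mul hdvd with h | ⟨d', rfl, h⟩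
  · rcases (dvd_mul_three_iff hr hp hq).mp h with rfl | rfl | rfl | rfl | rfl | rfl | rfl | rfl
    · omega
    · exact e3
    · exact ep
    · exact eq'
    · exact e3p
    · exact e3q
    · exact epq
    · exact e3pq
  · rcases (dvd_mul_three_iff hr hp hq).mp h with rfl | rfl | rfl | rfl | rfl | rfl | rfl | rfl
    · rw [mul_one]; exact e2
    · exact F d2 d3 d6 e2 e3
    · exact F d2 dp ⟨r * q, by rw [hn]; ring⟩ e2 ep
    · exact F d2 dq ⟨r * p, by rw [hn]; ring⟩ e2 eq'
    · exact F d2 d3p ⟨q, by rw [hn]; ring⟩ e2 e3p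
    · exact F d2 d3q ⟨p, by rw [hn]; ring⟩ e2 e3q
    · exact F d2 dpq ⟨r, by rw [hn]; ring⟩ e2 epq
    · exact F d2 d3pq ⟨1, by rw [hn]; ring⟩ e2 e3pq

/-! ## §3 The cell theorem for `n = 2rpq` -/

/-- **THE LOWER HALF OF C⁺ ON THE CELL `n = 2rpq`** (`r ≡ 3 (4)`, `p ≡ q ≡ 1 (8)`, `(−r/p) = (−r/q) = 1`, `(p/q) = −1`), display shape over
`D.Printed ∧ D.CMPointRingClassFrobeniusValuePrinted` (top pair witness, even coefficients `|𝓛(q)|, |𝓛(p)|` on `2rp, 2rq`, block `2r` automatic, no block `≡ 5`).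
[cite: TianYuanZhang2017, Thm. 1.1, Thm. 3.5, Lemma 3.18, §3.1, Prop. 3.2 (2), Thm. 3.6 (2), proof of Lemma 3.21] [cite: Cox2013, §5.C Cor. 5.25, §9.A] [cite: Darmon2004, Thm. 3.22] -/
theorem two_dvd_scriptL_two_rpq_of_valuePrinted (hGZK : rank_eq_analyticRank_of_analyticRank_le_one) (h11 : thm11_parity_of_scriptL)
    (hsq : Squarefree n) {r p q : ℕ} (hr : r.Prime) (hp : p.Prime) (hq : q.Prime) (hpq : p ≠ q) (hn : n = 2 * r * p * q) (hr4 : r % 4 = 3)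
    (hp8 : p % 8 = 1) (hq8 : q % 8 = 1) (hrp : jacobiSym (-(r : ℤ)) p = 1) (hrq : jacobiSym (-(r : ℤ)) q = 1) (hleg : jacobiSym p q = -1)
    (hra : haveI := isElliptic_congruentNumberCurve hsq.ne_zero; (congruentNumberCurve n).analyticRank = 1)
    (D : GenusPointData n) (hPr : D.Printed) (hV : D.CMPointRingClassFrobeniusValuePrinted)
    {x y : ℚ} (hxy : (congruentNumberCurve n).toAffine.Nonsingular x y)
    (hgen : haveI := isElliptic_congruentNumberCurve hsq.ne_zero;
      ∀ P, ∃ k : ℤ, IsOfFinAddOrder (P - k • (Point.some x y hxy : (congruentNumberCurve n).toAffine.Point)))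
    (hx : ¬ ∃ r : ℚ, x = r ^ 2 ∨ x = -r ^ 2 ∨ x = n * r ^ 2 ∨ x = -(n * r ^ 2))
    (hx2 : ¬ ∃ r : ℚ, x = 2 * r ^ 2 ∨ x = -(2 * r ^ 2) ∨ x = 2 * n * r ^ 2 ∨ x = -(2 * n * r ^ 2)) :
    ∀ L : ℤ, IsScriptL n L → (2 : ℤ) ∣ L := by
  have hn0 : n ≠ 0 := hsq.ne_zero
  have hnn : n ∈ n.divisors := Nat.mem_divisors_self n hn0
  have h6 : n % 8 = 6 := by
    rw [hn, show 2 * r * p * q = (2 * r) * (p * q) by ring, Nat.mul_mod, Nat.mul_mod p q, hp8, hq8, Nat.mul_mod 2 r]; omega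
  have hdvdn : ∀ {d : ℕ}, d ∈ n.divisors → d ∣ 2 * r * p * q := fun hd => hn ▸ Nat.dvd_of_mem_divisors hd
  obtain ⟨hLs, -, hrec, -, h35, -, -, -, h318, -, -⟩ := hPr
  obtain ⟨z, Φ, ΓH, ΓH', σ, θ, c, ρ₂, ρ₄, hc, hb⟩ := hV
  -- the top witness: the pair `φ_p φ_q`
  obtain ⟨φ₁, φ₂, ⟨h₁K, -, h₁i, h₁r⟩, ⟨h₂K, -, h₂i, h₂r⟩, hee, heH⟩ :=
    exists_pairWitness_of_clauses D hsq hb hnn h6 hp hq hpq (hn ▸ ⟨2 * r * q, by ring⟩) (hn ▸ ⟨2 * r * p, by ring⟩)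
      (by omega) (by omega)
  have heL : D.TrivialOnL n (φ₁ * φ₂) := trivialOnL_pair' D hsq hr hp hq hpq hn hr4 hp8 hq8 hrp hrq hleg h₁K h₁i h₁r h₂K h₂i h₂r
  refine two_dvd_scriptL_of_coefficients_even_of_x_not_mem D hGZK hsq h6 hra hrec h35 hLs h318 z Φ ΓH ΓH' σ c hc
    (fun d hd => ⟨(hb d hd).1, (hb d hd).2.2.1⟩) ⟨φ₁ * φ₂, heL, hee, heH⟩ (fun d hd hd6 hdn => ?_) (fun d hd hd5 => ?_) hxy hgen hx hx2
  · -- proper even blocks `2r`, `2rp`, `2rq`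
    rcases (divisors_two_mul_three' hr hp hq hr4 hp8 hq8 (hdvdn hd)).2 hd6 with rfl | rfl | rfl | rfl
    · exact Or.inl ⟨r, hr, rfl⟩
    · refine Or.inr (Or.inr ?_)
      rw [show n / (2 * r * p) = q by rw [hn]; exact Nat.mul_div_cancel_left q (Nat.mul_pos (Nat.mul_pos two_pos hr.pos) hp.pos)]
      exact even_scriptL_of_prime_one_mod_eight h11 D hLs hq hq8 (Nat.mem_divisors.mpr ⟨hn ▸ ⟨2 * r * p, by ring⟩, hn0⟩)
    · refine Or.inr (Or.inr ?_)
      rw [show n / (2 * r * q) = p by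
        rw [hn, show 2 * r * p * q = (2 * r * q) * p by ring]; exact Nat.mul_div_cancel_left p (Nat.mul_pos (Nat.mul_pos two_pos hr.pos) hq.pos)]
      exact even_scriptL_of_prime_one_mod_eight h11 D hLs hp hp8 (Nat.mem_divisors.mpr ⟨hn ▸ ⟨2 * r * q, by ring⟩, hn0⟩)
    · exact absurd hn.symm hdn
  · exact absurd hd5 (divisors_two_mul_three' hr hp hq hr4 hp8 hq8 (hdvdn hd)).1

/-- **THE LOWER HALF ON THE CELL `n = 2rpq` FROM THE NAMED FACTS** (`OfFacts` shape, by-name closable):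
`(tyz_cmPointRingClassFrobeniusValueData ∧ thm11_parity_of_scriptL ∧ GZK)` implies — for primes `r, p, q`, `r ≡ 3 (mod 4)`, `p ≡ q ≡ 1 (mod 8)`, `p ≠ q`,
`(−r/p) = (−r/q) = 1`, `(p/q) = −1`, `n = 2rpq` square-free, `ord_{s=1} L(E_n, s) = 1`, and a generator `R = (x, y)` of `E_n(ℚ)` modulo torsion with
`x ∉ {±1, ±2, ±n, ±2n}·ℚ^{×2}` — `2 ∣ L` whenever `𝓛(n)² = L²`.
[cite: TianYuanZhang2017, Thm. 1.1, §1, §3, Prop. 3.2 (2)] [cite: Cox2013, §5.C Cor. 5.25, §9.A] [cite: HeathBrown1994SelmerCongruentII, §1] [cite: Darmon2004, Thm. 3.22] -/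
theorem two_dvd_scriptL_two_rpq_of_facts :
    (tyz_cmPointRingClassFrobeniusValueData ∧ thm11_parity_of_scriptL ∧ rank_eq_analyticRank_of_analyticRank_le_one) →
      ∀ n r p q : ℕ, (hsq : Squarefree n) → r.Prime → p.Prime → q.Prime → p ≠ q → n = 2 * r * p * q → r % 4 = 3 → p % 8 = 1 → q % 8 = 1 →
        jacobiSym (-(r : ℤ)) p = 1 → jacobiSym (-(r : ℤ)) q = 1 → jacobiSym p q = -1 →
        (haveI := isElliptic_congruentNumberCurve hsq.ne_zero; (congruentNumberCurve n).analyticRank = 1) →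
        ∀ (x y : ℚ) (hxy : (congruentNumberCurve n).toAffine.Nonsingular x y),
          (haveI := isElliptic_congruentNumberCurve hsq.ne_zero;
            ∀ P, ∃ k : ℤ, IsOfFinAddOrder (P - k • (Point.some x y hxy : (congruentNumberCurve n).toAffine.Point))) →
          (¬ ∃ r : ℚ, x = r ^ 2 ∨ x = -r ^ 2 ∨ x = n * r ^ 2 ∨ x = -(n * r ^ 2)) →
          (¬ ∃ r : ℚ, x = 2 * r ^ 2 ∨ x = -(2 * r ^ 2) ∨ x = 2 * n * r ^ 2 ∨ x = -(2 * n * r ^ 2)) →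
            ∀ L : ℤ, IsScriptL n L → (2 : ℤ) ∣ L := by
  intro h n r p q hsq hr hp hq hpq hn hr4 hp8 hq8 hrp hrq hleg hra x y hxy hgen hx hx2
  have h6 : n % 8 = 6 := by
    rw [hn, show 2 * r * p * q = (2 * r) * (p * q) by ring, Nat.mul_mod, Nat.mul_mod p q, hp8, hq8, Nat.mul_mod 2 r]; omega
  obtain ⟨D, hPr, hV⟩ := h.1 n hsq (Or.inr (Or.inl h6))
  exact two_dvd_scriptL_two_rpq_of_valuePrinted h.2.2 h.2.1 hsq hr hp hq hpq hn hr4 hp8 hq8 hrp hrq hleg hra D hPr hV hxy hgen hx hx2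

end Summit.BirchSwinnertonDyer.PrintCf2.TwoRPQ

end
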